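import Literature.Algebra.Module.EigenvalueLattice
import Mathlib.RingTheory.IntegralClosure.Algebra.Basic
import HarnessLib

/-!
# Eigenvalues of lattice-preserving operators are integral

Topic `Algebra/Module`; namespace `Literature.Algebra.Module`.  One theorem (Mathlib +
`EigenvalueLattice`); no definition, no named fact, no instance, no `sorry`.

Complement to `EigenvalueLattice`: with `R → k'` (`k'` a field), `H` a `k'`-vector space,
`L ⊆ H` a finitely generated `R`-submodule (`R` Noetherian) and `0 ≠ η ∈ L`, every eigenvalue
`a` on `η` of a `k'`-linear operator preserving `L` is **integral over `R`**
(`isIntegral_eigenvalue`): `a` multiplies the finitely generated faithful `R`-module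
`scalingSubmodule L η = {c | c η ∈ L} ∋ 1` into itself (Mathlib `isIntegral_of_smul_mem_submodule`).
E.g. Hecke eigenvalues on a class of `H^q(X_U, M̃) ⊗ ℚ̄_p` coming from the image of the
finitely generated `H^q(X_U, M̃)` are `p`-adically integral [Scholze2015, §V.4].

## References

* N. Bourbaki, *Algèbre commutative*, Ch. V §1 no. 1, Prop. 1 (integrality via a faithful finitely
  generated module). [folklore]
* P. Scholze, Ann. of Math. 182 (2015), §V.4. [Scholze2015]
-/

namespace Literature.Algebra.Module

variable {R k' : Type*} [CommRing R] [Field k'] [Algebra R k'] {H : Type*} [AddCommGroup H]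
  [Module k' H] [Module R H] [IsScalarTower R k' H] (L : Submodule R H) (η : H)

/-- **Eigenvalues on `η ∈ L ∖ 0` of `L`-preserving operators are integral over `R`** (`L` finitely
generated, `R` Noetherian). [cite: Scholze2015, §V.4] -/
theorem isIntegral_eigenvalue [IsNoetherianRing R] (hL : L.FG) (hηL : η ∈ L) (hη : η ≠ 0)
    (T : H →ₗ[k'] H) (hT : ∀ v ∈ L, T v ∈ L) (a : k') (ha : T η = a • η) : IsIntegral R a := by
  have h1 : (1 : k') ∈ scalingSubmodule k' L η := by
    rw [mem_scalingSubmodule_iff, one_smul]; exact hηL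
  refine isIntegral_of_smul_mem_submodule (scalingSubmodule k' L η) (fun h0 => ?_)
    (scalingSubmodule_fg k' L η hL hη) a (fun c hc => ?_)
  · rw [h0] at h1
    exact one_ne_zero ((Submodule.mem_bot R).1 h1)
  · rw [mem_scalingSubmodule_iff] at hc ⊢
    rw [smul_eq_mul, mul_comm, mul_smul, ← ha, ← map_smul]
    exact hT _ hc

end Literature.Algebra.Module
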